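import Summits.HodgeConjecture.HodgeConjecture.Theorems.WeilTypeLadderQuadraticVariational
import Summits.HodgeConjecture.HodgeConjecture.Theorems.HeckePrymWeilHyperbolicEightfoldsSqrtMinus7LerayFact
import HarnessLib

/-!
# WeilTypeLadder · R∞anc in SECTION form (flat section of `R^{2n}f_*ℂ`) implies the TOTAL-SPACE-CLASS form (DIVERGENCE D8 (c)(i))

b2b cell `hweil` (packet `run/shared/lean/b2b/hodge-weil/`, DIVERGENCE.md D8 (c)(i): "a class on the total space instead of
print's flat section of `R^{2n}f_*ℚ` — equivalent only modulo Deligne's theorem of the fixed part (Hodge II 4.1.1; NOT in the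
tree), so the decl is formally STRONGER in what it demands of the family"). Prover 2, generation 2 (variational).

The tree DOES prove the relevant case of the theorem of the fixed part: a CONTINUOUS section of the étalé space of fibre classes
`FiberClass f k` over a smooth irreducible quasi-projective base of a smooth projective family that is closed in some `ℙᴺ × S`
is the restriction of a GLOBAL class of the total space — `Theorems.HyperbolicEightfoldsSqrtMinus7.TensorAnchor.stub_globalClassEngine`
(crux 14642 lead c11; from `deligne1968_invariantClass_fromTotalSpace_holds`, Deligne 1968 discharged through the Leray engine).
This file records the consequence for the ladder: the SECTION form of the anchor-supply leaf R∞anc (anchor supply with a continuous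
Weil section `s ↦ (s, y s)` through `c`, fibrewise rational `(n,n)` and Weil-confined, algebraic at `s₀`, on a family closed in
`ℙᴺ × S`) IMPLIES the landed total-space-class form `AnchoredWeilFamiliesQuadratic`. So D8 (c)(i) costs exactly the projective-
embedding clause (which Deligne's PEL families satisfy: `f` projective, [Chai] / MFK), nothing more. Sorry-free; no definition.
Serves stmt-HodgeConjecture-2522 without closing it.
-/

-- every declaration of this problem lives in `Summit.HodgeConjecture.HodgeConjecture.…` (summit = sub-problem)
set_option linter.dupNamespace false

noncomputable section

open CategoryTheory AlgebraicGeometry Limits MonoidalCategory CartesianMonoidalCategory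

namespace Summit.HodgeConjecture.HodgeConjecture.WeilTypeLadder

open Literature.AlgebraicGeometry Literature.AlgebraicGeometry.Motives
open Literature.AlgebraicGeometry.HodgeTheory
open Literature.AlgebraicTopology.SingularHomology
open Summit.HodgeConjecture.HodgeConjecture.Theorems.HyperbolicEightfoldsSqrtMinus7.TensorAnchor (stub_globalClassEngine)

/-- **R∞anc, SECTION form ⟹ total-space-class form.** Suppose that for every non-zero rational `(n,n)` Weil class `c` of an
abelian `2n`-fold `(A, φ² = -d)` there are a smooth projective family `f : 𝒳 ⟶ S` CLOSED IN SOME `ℙᴺ × S` over a smooth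
irreducible quasi-projective base (`𝒳` quasi-projective), points `s₁ s₀`, a chart `ι : A.X ≅ 𝒳_{s₁}`, and a CONTINUOUS section
`s ↦ (s, y s)` of the fibre-class space `FiberClass f (2n)` (print's flat section of `R^{2n}f_*ℂ`) with values rational of type
`(n,n)`, carried by abelian charts into the Weil planes, `ι^*(y s₁) = c` and `y s₀` algebraic. Then `AnchoredWeilFamiliesQuadratic`
holds: by the tree's theorem of the fixed part (`stub_globalClassEngine`) the section is `s ↦ (s, W|_{𝒳_s})` for a global class
`W ∈ H^{2n}(𝒳(ℂ); ℂ)`. [cite: Deligne1968, Thm. 1.5 and §2 (invariant cycles)] [cite: VoisinHodgeII2003, Thm. 4.24]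
[cite: Markman2025SecantWeil, §2.4 (flat deformation of the class)] -/
theorem anchoredWeilFamiliesQuadratic_of_sectionForm
    (h : ∀ (n : ℕ), 2 ≤ n → ∀ (d : ℕ), 0 < d → ∀ (A : Motives.AbelianVariety ℂ) (φ : A ⟶ A), A.dim = 2 * n →
      Motives.IsSmoothProjective (2 * n) A.X → φ ≫ φ = -(d • 𝟙 A) →
        ∀ c : complexBetti A.X (2 * n), IsRationalClass c → IsOfHodgeType (2 * n) A.X (2 * n) n n c →
          c ∈ weilClassesOf A φ n d → c ≠ 0 →
          ∃ (𝒳 S : Motives.SchemeOver ℂ) (f : 𝒳 ⟶ S) (s₁ s₀ : Motives.ComplexPoints S)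
              (ι : A.X ≅ Motives.fiberOver f s₁) (y : ∀ s : Motives.ComplexPoints S, complexBetti (Motives.fiberOver f s) (2 * n)),
            Motives.IsSmoothProjectiveFamily f (2 * n) ∧
            (∃ (N : ℕ) (ι' : 𝒳 ⟶ Motives.projectiveSpace N ℂ ⊗ S),
                IsClosedImmersion ι'.left ∧ ι' ≫ snd (Motives.projectiveSpace N ℂ) S = f) ∧
            IsQuasiProjectiveOver 𝒳 ∧ IsQuasiProjectiveOver S ∧
            IrreducibleSpace S.left ∧ AlgebraicGeometry.Smooth S.hom ∧
            Continuous (fun s ↦ (⟨s, y s⟩ : FiberClass f (2 * n))) ∧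
            (∀ s : Motives.ComplexPoints S, IsRationalClass (y s) ∧
                IsOfHodgeType (2 * n) (Motives.fiberOver f s) (2 * n) n n (y s)) ∧
            (∀ s : Motives.ComplexPoints S, ∃ (A' : Motives.AbelianVariety ℂ) (φ' : A' ⟶ A')
                (e' : A'.X ≅ Motives.fiberOver f s),
              A'.dim = 2 * n ∧ φ' ≫ φ' = -(d • 𝟙 A') ∧ complexBetti.map e'.hom (2 * n) (y s) ∈ weilClassesOf A' φ' n d) ∧
            complexBetti.map ι.hom (2 * n) (y s₁) = c ∧
            y s₀ ∈ algebraicClasses (Motives.fiberOver f s₀) n) :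
    AnchoredWeilFamiliesQuadratic := by
  intro n hn d hd A φ hAdim hX hφ c hcQ hcH hc hc0
  obtain ⟨𝒳, S, f, s₁, s₀, ι, y, hf, hemb, h𝒳, hS, hirr, hsm, hcont, hy, hWeil, hread, hs₀⟩ :=
    h n hn d hd A φ hAdim hX hφ c hcQ hcH hc hc0
  haveI := hirr
  -- the theorem of the fixed part (tree): the continuous section is the restriction of a global class
  obtain ⟨W, hWσ⟩ := stub_globalClassEngine f (2 * n) (2 * n) hf hemb hsm hS hirr (fun s ↦ ⟨s, y s⟩) hcont (fun _ ↦ rfl)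
  have hWs : ∀ s, complexBetti.map (Motives.fiberι f s) (2 * n) W = y s := by
    intro s
    have h' := (hWσ s).symm
    simp only [globalSection, FiberClass.mk.injEq, heq_eq_eq, true_and] at h'
    exact h'
  refine ⟨𝒳, S, f, s₁, s₀, ι, W, hf, h𝒳, hS, hirr, hsm, ?_, ?_, ?_, ?_⟩
  · intro s; rw [hWs s]; exact hy s
  · intro s
    obtain ⟨A', φ', e', hA', hφ', hmem⟩ := hWeil s
    exact ⟨A', φ', e', hA', hφ', by rw [hWs s]; exact hmem⟩
  · rw [hWs s₁]; exact hread
  · rw [hWs s₀]; exact hs₀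

end Summit.HodgeConjecture.HodgeConjecture.WeilTypeLadder

end
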